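import Literature.MathematicalPhysics.QuantumFieldTheory.Balaban1983to89.B9B8KnitLetterEntriesTransfer
import Literature.MathematicalPhysics.QuantumFieldTheory.Balaban1983to89.B9Ineq349WordDiffHom
import Literature.MathematicalPhysics.QuantumFieldTheory.Balaban1983to89.B9Eq376DerivDict
import Literature.MathematicalPhysics.QuantumFieldTheory.Balaban1983to89.B9Cor35GpCubeInputsAtOne

/-!
# `Balaban1983to89.B9B8KnitBondGpLettersAtPars` — THE `G′`-SECTOR OF THE BOND JUNCTION AT `(parSymY, parKnitY)`: the two-space LEFT entry
# `conĵ(D_U)∘conj b(η²G′(U; parKnitY))`, the RIGHT entry `conj b(η²G′(U; parSymY))∘conĵ(D*_U)`, and the DIFFERENCES of the left and of the right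
# entries between the two letters, as block majorants over the member's geometry — four of the ten displayed inputs of FILE 2b
# `B9B8KnitBondWordDiff.hasMajorant_conj_DPDsY_sub`, discharged from the junction files 8∕9∕10, r06's derivative dictionary and FILE 2a
# (junction J-B, bond sector, FILE 2c-i; seat p38; consumer: the assembly FILE 2c-iii ∕ t2s-1 g10's FILE 5)

T. Bałaban, *Propagators for lattice gauge theories in a background field*, Commun. Math. Phys. **99** (1985) 389–434
[`Balaban1985BackgroundPropagators`, "B9"]; [4] = *Propagators and renormalization transformations … II*, Commun. Math. Phys. **96** (1984)
223–250 [`Balaban1984PropagatorsII`]; [A] = *Averaging operations for lattice gauge theories*, Commun. Math. Phys. **98** (1985) 17–51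
[`Balaban1985Averaging`].

statement-level skeleton of published theorems with citation tags; proofs where landed; nothing here is a claim about the
Yang–Mills mass gap

THE PRINTED LOCUS (verbatim up to notation; page owner r06).  (3.42) p. 397 («|(∇_UG(U)λ)(b)|, |(G(U)∇*_Uλ)(x)| ≦ B₀(Lʲη)e^{−δ₀d(y,y′)}|λ|»); (3.25) p. 394;
(3.90) p. 409 («G′ = G′₀(I − R′)⁻¹»), (3.106) p. 414 — the resolvent device; (3.19) p. 393 vs (3.40) p. 397 (print has ONE transporter convention:
the junction between def-Y's `parSymY` and the knit's `parKnitY` is a formalisation artefact priced by (3.90)-type resolvent identities);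
[4] (2.50)–(2.55) p. 232, Lemma 2.1 (2.60)–(2.61) p. 234; [A] (17)–(20) pp. 20–21, (52) p. 27 (the small-field class).

WHY THIS FILE (cell `lit-balaban`; seat p38 gen 46; lead g34 RULING JUNCTION-PARS (T) 2026-08-28T23:20Z).  FILE 2b's engine at `(par₁, par₂) =
(parSymY, parKnitY)` needs, in the `G′`-sector, exactly: the two-space LEFT entry at the KNIT letter (`X₂`), the RIGHT entry at the letter of record
(`Y₁`), and the two differences (`X₁ − X₂`, `Y₁ − Y₂`).  t2s-1 g10's junction files give, from M5.5's (3.42) data AT `parSymY` and the class (52):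
the plain knit letter (file 9 `B9B8KnitLetterMajorantTransfer.hasMajorant_conj_GpY_parKnitY_of_parSymY_len`), every LEFT product `E_b∘conj b(η²G′_knit)`
from the same product at `parSymY` (file 10 `B9B8KnitLetterEntriesTransfer.hasMajorant_left_conj_GpY_parKnitY_of_parSymY_len`), the block-diagonal
majorant of `η⁻²(Δ′_sym − Δ′_knit)` (file 9 §1) and the resolvent identity `G′_knit = G′_sym + G′_knit(Δ′_sym − Δ′_knit)G′_sym` (file 8).  THIS FILE
composes them: the `d + 1` directional left products at the knit letter are summed into the two-space letter by r06's `B9Eq376DerivDict.hasMajorantHom_gradLin`,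
the right products at `parSymY` by `hasMajorantHom_divLin`; the differences are `X₁ − X₂ = X₂∘E∘G_S` and `Y₁ − Y₂ = G_K∘E∘Y₁` with `E = conj b(η⁻²(Δ′_knit − Δ′_sym))`
(§1), priced by FILE 2a's `hasMajorantHom_leftDiff` ∕ `_rightDiff`.

WHAT THIS FILE PROVES (THEOREMS; 0 `def`, 0 `def … : Prop`, 0 sorry; standard axioms).  Throughout `𝔸 = M_N(ℂ)`, `G ≤ U(N)` closed under averaging,
`U ∈ G` in the class (52) `pdev U < α₀′L^{−2k}`, `c_f = L^k` (so `η = etaS i = L^{−k}`), an ℝ-basis `b` with coordinate constant `M₂`, a labelling `ιB`.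
* §1 `smul_GpY_sym_sub_knit_eq` (`η²G′_S − η²G′_K = (η²G′_K)(η⁻²(Δ′_K − Δ′_S))(η²G′_S)` in `End_ℝ`), `conj_GpY_sym_sub_knit_eq`, `leftEntry_sub_eq`, `rightEntry_sub_eq`
  (the factorizations FILE 2a prices), `hasMajorant_conj_E` (`conj b(η⁻²(Δ′_K − Δ′_S))` is block-diagonal `≺ θ_E𝟙`, `θ_E = 32(d+1)²α₀′·M₂Σ‖b_j‖`, file 9 §1).
* §2 ★★ `hasMajorantHom_leftEntry_parKnitY` — `conĵ(D_U)∘conj b(η²G′(U; parKnitY)) ≺ B_X·ℓ(a)·e^{−(1−α)δ₀d}`, `B_X = A₁(1 + c₁θc₁(1 − θc₁)⁻¹)`, from the displayed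
  `parSymY` data `conj b(η²G′_S) ≺ Aℓ²e^{−δ₀d}` (`hGs`) and the `d+1` directional left products `conj b(∂_μ)·conj b(η²G′_S) ≺ A₁ℓe^{−δ₀d}` (`hDl`).
* §2 ★★ `hasMajorantHom_rightEntry_parSymY` — `conj b(η²G′(U; parSymY))∘conĵ(D*_U) ≺ (d+1)A₂·ℓ(a)·e^{−δ₀d}` from the `d+1` directional right products (`hDr`).
* §3 ★★★ `hasMajorantHom_leftEntry_sym_sub_knit` — `conĵ(D_U)∘conj b(η²G′_S) − conĵ(D_U)∘conj b(η²G′_K) ≺ (B_X·θ_E·A·Λ·c₁(d_b,δ_b,β_b))·ℓ(a)·e^{−ρd}` for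
  `ρ + (α_b+β_b)δ_b ≤ (1−α)δ₀`, the transfer of `ℓ²` and (2.61) at `(δ_b; α_b, β_b)`.
* §3 ★★★ `hasMajorantHom_rightEntry_sym_sub_knit` — `conj b(η²G′_S)∘conĵ(D*_U) − conj b(η²G′_K)∘conĵ(D*_U) ≺ (A_K·θ_E·(d+1)A₂·Λ·c₁)·ℓ(a)·e^{−ρd}`,
  `A_K = Ac₁(1 − θc₁)⁻¹` (file 9's knit constant).

HONEST SCOPE ∕ NOT CLAIMED.  Composition of landed junction files with r06's dictionary and FILE 2a; the `parSymY`-side member data (`hGs`, `hDl`, `hDr`)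
stay DISPLAYED (M5.5 `B9Thm37GpTorusRegular*` ∕ M5.7 supply them through the (3.42) blocks); the `Q′`∕`X⁻¹`-sector and the assembly into FILE 2b are the
sibling files 2c-ii∕iii.  Block-majorant (operator) form.  NOT a node discharge; no summit ∕ sub-problem statement is proved; nothing continuum ∕ OS ∕
mass-gap ∕ Clay; YM mass gap NOT proved by any of this (Track A conditional rung).  No `sorry`, no `axiom`, no `… : Prop` fact, no `instance`, no
`notation`, no `def`.  NEW file; nothing landed is modified.  `--supports stmt-QuantumFields-19200` as helper.  Net new unproved facts: 0.

RELATED IN THE TREE, NOT DUPLICATED (searched 2026-08-29: `rg 'gradLin .*parKnitY|leftEntry_parKnitY' Literature/` = ∅): files 9∕10∕16 give LEFT PRODUCTS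
`E_b∘conj b(η²G′_K)` for ONE real factor `E_b` (site carrier); the two-space letter and the differences are new here.  23b
`B9B8KnitLetterXDiffMajorant.hasMajorant_conj_GpDiff` is the PLAIN difference `η²(G′_K − G′_S)` (no derivative) — not what the engine consumes.
-/

noncomputable section

namespace Literature.MathematicalPhysics.QuantumFieldTheory.Balaban1983to89.B9B8KnitBondGpLettersAtPars

open Node00
open B6Geom246MultiLevelBox (blkOf)
open B6KLevelCensusIndexV1 (KIdx)
open B6RandomWalk (HasMajorant Triangle254 Ineq261 Ineq263 hasMajorant_mono c1_nonneg)
open B6RandomWalkHom (HasMajorantHom hasMajorantHom_mono)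
open B9Thm34Ext (toB6)
open B9GeoNormsKLevelV1 (geo9K geo9K_dist_nonneg)
open B9GeoLemma21KLevelV1 (geo9K_len_pos)
open B9Ineq347 (ScaleTransfer)
open B9Eq352DivFormLetters (conj conj_mul conj_sub conj_neg)
open B9Eq352GradLetters (diffLetter)
open B9Eq376POneLetters (conjHom gradLin divLin)
open B9Eq376DerivDict (hasMajorantHom_gradLin hasMajorantHom_divLin)
open B9Thm37GpTorusRegular (conj_smul)
open B9Cor35GpCubeInputsAtOne (hasMajorant_neg)
open B9Ineq349WordDiffHom (hasMajorantHom_leftDiff hasMajorantHom_rightDiff)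
open B9B8KnitLetterMajorantTransfer (hasMajorant_conj_smul_sub inv_etaS_sq_mul geo9K_len_sq_le_one hasMajorant_conj_GpY_parKnitY_of_parSymY_len)
open B9B8KnitLetterEntriesTransfer (hasMajorant_left_conj_GpY_parKnitY_of_parSymY_len)
open B9B8KnitLetterResolvent (GpY_parKnitY_eq')
open B7Prop2Explicit (AvgClosed pdev C0 c2')
open B9B8CarrierDictionary (liftCfg)
open B9B8AveragingJunction (parKnitY)
open B9B8KnitLetterRegular (parKnitY_mem_of_pdev)
open scoped Matrix Matrix.Norms.L2Operator

variable {d ℓ : ℕ} {hd : 1 ≤ d + 1} {hL : Odd (ℓ + 1) ∧ 1 < ℓ + 1} {b₀ b₁ : ℝ}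
variable (i : KIdx d ℓ hd hL b₀ b₁) {N : ℕ} {G : Subgroup (Matrix (Fin N) (Fin N) ℂ)ˣ}
variable {ι : Type} [Fintype ι] [DecidableEq ι] (b : Module.Basis ι ℝ (Matrix (Fin N) (Fin N) ℂ))
variable [Fintype (geo9K i).Site] [DecidableEq (geo9K i).Site] {Rr : ℝ} {Hp : Prop} (ιB : BlkY i → IBondY i)

/-! ## §1  The factorizations of the differences and the block-diagonal letter `E = η⁻²(Δ′_knit − Δ′_sym)` -/

section Algebra

omit [Fintype (geo9K i).Site] [DecidableEq (geo9K i).Site] in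
/-- **`η²G′_S − η²G′_K = (η²G′_K)·(η⁻²(Δ′_K − Δ′_S))·(η²G′_S)`** in `End_ℝ` — file 8's resolvent identity `G′_K = G′_S + G′_K(Δ′_S − Δ′_K)G′_S` with the `η`-units
distributed. [cite: Balaban1985BackgroundPropagators, (3.90) p.409, (3.106) p.414; Balaban1984PropagatorsII, (2.50) p.232] -/
theorem smul_GpY_sym_sub_knit_eq (hG : G ≤ B7Prop2Explicit.unitaryUnits (Matrix (Fin N) (Fin N) ℂ)) {U : CfgY (Matrix (Fin N) (Fin N) ℂ) i}
    (hU : ∀ μ x, U μ x ∈ G) (hpar : ∀ z w : SiteY i, parKnitY i U z w ∈ G) {η : ℝ} (hη : η ≠ 0) :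
    ((η ^ 2) • (GpY i (parSymY i) U).restrictScalars ℝ - (η ^ 2) • (GpY i (parKnitY i) U).restrictScalars ℝ :
        Module.End ℝ (SiteY i → Matrix (Fin N) (Fin N) ℂ)) =
      ((η ^ 2) • (GpY i (parKnitY i) U).restrictScalars ℝ) *
        (((η ^ 2)⁻¹) • (deltaPrimeAY i (parKnitY i) U - deltaPrimeAY i (parSymY i) U).restrictScalars ℝ) *
        ((η ^ 2) • (GpY i (parSymY i) U).restrictScalars ℝ) := by
  have hGG : GpY i (parSymY i) U - GpY i (parKnitY i) U =
      GpY i (parKnitY i) U * (deltaPrimeAY i (parKnitY i) U - deltaPrimeAY i (parSymY i) U) * GpY i (parSymY i) U := by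
    have h := GpY_parKnitY_eq' i hG hU hpar
    calc GpY i (parSymY i) U - GpY i (parKnitY i) U
        = GpY i (parSymY i) U - (GpY i (parSymY i) U
            + GpY i (parKnitY i) U * (deltaPrimeAY i (parSymY i) U - deltaPrimeAY i (parKnitY i) U) * GpY i (parSymY i) U) := by
          rw [← h]
      _ = GpY i (parKnitY i) U * (deltaPrimeAY i (parKnitY i) U - deltaPrimeAY i (parSymY i) U) * GpY i (parSymY i) U := by
          rw [mul_sub, sub_mul, mul_sub, sub_mul]
          abel
  have h1 : η ^ 2 * (η ^ 2 * (η ^ 2)⁻¹) = η ^ 2 := by rw [mul_inv_cancel₀ (pow_ne_zero 2 hη), mul_one]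
  refine LinearMap.ext fun Φ => ?_
  have e2 := congrArg (fun T : (SiteY i → Matrix (Fin N) (Fin N) ℂ) →ₗ[ℂ] (SiteY i → Matrix (Fin N) (Fin N) ℂ) => (η ^ 2) • T Φ) hGG
  simp only [LinearMap.sub_apply, Module.End.mul_apply, smul_sub] at e2
  simp only [LinearMap.sub_apply, LinearMap.smul_apply, Module.End.mul_apply, LinearMap.restrictScalars_apply, LinearMap.map_smul_of_tower,
    smul_smul, h1, map_sub]
  simp only [map_sub] at e2
  exact e2

omit [DecidableEq ι] [Fintype (geo9K i).Site] [DecidableEq (geo9K i).Site] in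
/-- the same after conjugation into real coordinates: `conj b(η²G′_S) − conj b(η²G′_K) = conj b(η²G′_K)·conj b(η⁻²(Δ′_K − Δ′_S))·conj b(η²G′_S)`.
[cite: Balaban1984PropagatorsII, (2.51)–(2.52) p.232; Balaban1985BackgroundPropagators, (3.90) p.409] -/
theorem conj_GpY_sym_sub_knit_eq (hG : G ≤ B7Prop2Explicit.unitaryUnits (Matrix (Fin N) (Fin N) ℂ)) {U : CfgY (Matrix (Fin N) (Fin N) ℂ) i}
    (hU : ∀ μ x, U μ x ∈ G) (hpar : ∀ z w : SiteY i, parKnitY i U z w ∈ G) {η : ℝ} (hη : η ≠ 0) :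
    conj b ((η ^ 2) • (GpY i (parSymY i) U).restrictScalars ℝ) - conj b ((η ^ 2) • (GpY i (parKnitY i) U).restrictScalars ℝ) =
      conj b ((η ^ 2) • (GpY i (parKnitY i) U).restrictScalars ℝ) *
        conj b (((η ^ 2)⁻¹) • (deltaPrimeAY i (parKnitY i) U - deltaPrimeAY i (parSymY i) U).restrictScalars ℝ) *
        conj b ((η ^ 2) • (GpY i (parSymY i) U).restrictScalars ℝ) := by
  rw [← conj_sub, smul_GpY_sym_sub_knit_eq i hG hU hpar hη, B9Eq352DivFormLetters.conj_mul, B9Eq352DivFormLetters.conj_mul]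

omit [DecidableEq ι] [Fintype (geo9K i).Site] [DecidableEq (geo9K i).Site] in
/-- **LEFT**: `L∘conj b(η²G′_S) − L∘conj b(η²G′_K) = (L∘conj b(η²G′_K)) ∘ conj b(η⁻²(Δ′_K − Δ′_S)) ∘ conj b(η²G′_S)` for any two-space left factor `L` (FILE 2a's
`X₂∘E∘G₁`). [cite: Balaban1984PropagatorsII, (2.52) p.232; Balaban1985BackgroundPropagators, (3.90) p.409] -/
theorem leftEntry_sub_eq (hG : G ≤ B7Prop2Explicit.unitaryUnits (Matrix (Fin N) (Fin N) ℂ)) {U : CfgY (Matrix (Fin N) (Fin N) ℂ) i}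
    (hU : ∀ μ x, U μ x ∈ G) (hpar : ∀ z w : SiteY i, parKnitY i U z w ∈ G) {η : ℝ} (hη : η ≠ 0) {P : Type}
    (L : (SiteY i × ι → ℝ) →ₗ[ℝ] (P → ℝ)) :
    L ∘ₗ conj b ((η ^ 2) • (GpY i (parSymY i) U).restrictScalars ℝ) - L ∘ₗ conj b ((η ^ 2) • (GpY i (parKnitY i) U).restrictScalars ℝ) =
      (L ∘ₗ conj b ((η ^ 2) • (GpY i (parKnitY i) U).restrictScalars ℝ)) ∘ₗ
        conj b (((η ^ 2)⁻¹) • (deltaPrimeAY i (parKnitY i) U - deltaPrimeAY i (parSymY i) U).restrictScalars ℝ) ∘ₗ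
        conj b ((η ^ 2) • (GpY i (parSymY i) U).restrictScalars ℝ) := by
  rw [← LinearMap.comp_sub, conj_GpY_sym_sub_knit_eq i b hG hU hpar hη, Module.End.mul_eq_comp, Module.End.mul_eq_comp]
  simp only [LinearMap.comp_assoc]

omit [DecidableEq ι] [Fintype (geo9K i).Site] [DecidableEq (geo9K i).Site] in
/-- **RIGHT**: `conj b(η²G′_S)∘R − conj b(η²G′_K)∘R = conj b(η²G′_K) ∘ conj b(η⁻²(Δ′_K − Δ′_S)) ∘ (conj b(η²G′_S)∘R)` for any two-space right factor `R` (FILE 2a's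
`G₂∘E∘Y₁`). [cite: Balaban1984PropagatorsII, (2.52) p.232; Balaban1985BackgroundPropagators, (3.90) p.409] -/
theorem rightEntry_sub_eq (hG : G ≤ B7Prop2Explicit.unitaryUnits (Matrix (Fin N) (Fin N) ℂ)) {U : CfgY (Matrix (Fin N) (Fin N) ℂ) i}
    (hU : ∀ μ x, U μ x ∈ G) (hpar : ∀ z w : SiteY i, parKnitY i U z w ∈ G) {η : ℝ} (hη : η ≠ 0) {P : Type}
    (R : (P → ℝ) →ₗ[ℝ] (SiteY i × ι → ℝ)) :
    conj b ((η ^ 2) • (GpY i (parSymY i) U).restrictScalars ℝ) ∘ₗ R - conj b ((η ^ 2) • (GpY i (parKnitY i) U).restrictScalars ℝ) ∘ₗ R =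
      conj b ((η ^ 2) • (GpY i (parKnitY i) U).restrictScalars ℝ) ∘ₗ
        conj b (((η ^ 2)⁻¹) • (deltaPrimeAY i (parKnitY i) U - deltaPrimeAY i (parSymY i) U).restrictScalars ℝ) ∘ₗ
        (conj b ((η ^ 2) • (GpY i (parSymY i) U).restrictScalars ℝ) ∘ₗ R) := by
  rw [← LinearMap.sub_comp, conj_GpY_sym_sub_knit_eq i b hG hU hpar hη, Module.End.mul_eq_comp, Module.End.mul_eq_comp]
  simp only [LinearMap.comp_assoc]

omit [DecidableEq ι] in
/-- **THE BLOCK-DIAGONAL LETTER** `E = conj b(η⁻²(Δ′_knit − Δ′_sym)) ≺ θ_E𝟙`, `θ_E = 32(d+1)²α₀′·M₂Σ_j‖b_j‖` (file 9 §1 at `c = η⁻²`, `η = L^{−k}`: `η⁻²·L^{−2k} = 1`; a majorant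
of `T` is one of `−T`). [cite: Balaban1985Averaging, (17)–(20) pp.20–21, (52) p.27; Balaban1984PropagatorsII, (2.51) p.232] -/
theorem hasMajorant_conj_E [Nonempty (Fin N)] (hG : G ≤ B7Prop2Explicit.unitaryUnits (Matrix (Fin N) (Fin N) ℂ))
    (hGa : AvgClosed (d + 1) (ℓ + 1) G) {U : CfgY (Matrix (Fin N) (Fin N) ℂ) i} (hU : ∀ μ x, U μ x ∈ G)
    {α₀' : ℝ} (hα : 0 < α₀') (hα3 : C0 (d + 1) * α₀' ≤ 1 / 3) (hα2 : 2 * α₀' ≤ c2' (d + 1) (ℓ + 1))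
    (h52 : pdev (liftCfg U) < α₀' * ((((ℓ + 1 : ℕ) : ℝ) ^ i.k)⁻¹) ^ 2)
    {M₂ : ℝ} (hM₂ : 0 ≤ M₂) (hrepr : ∀ (v : Matrix (Fin N) (Fin N) ℂ) (j : ι), |b.repr v j| ≤ M₂ * ‖v‖) :
    HasMajorant (g := toB6 (geo9K i) Rr Hp) (fun p : SiteY i × ι => ιB (blkOf i.D.toDomains p.1))
      (conj b (((etaS i ^ 2)⁻¹) • (deltaPrimeAY i (parKnitY i) U - deltaPrimeAY i (parSymY i) U).restrictScalars ℝ))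
      (fun a a' : (geo9K i).Site => if a = a' then 32 * ((d : ℝ) + 1) ^ 2 * α₀' * (M₂ * ∑ j, ‖b j‖) else 0) := by
  have h := hasMajorant_conj_smul_sub i b ιB (Rr := Rr) (Hp := Hp) hG hGa hU hα hα3 hα2 h52 hM₂ hrepr ((etaS i ^ 2)⁻¹)
  have habs : |(etaS i ^ 2)⁻¹| * (32 * ((d : ℝ) + 1) ^ 2 * α₀' * (((((ℓ + 1) ^ i.k : ℕ) : ℝ)) ^ 2)⁻¹) * (M₂ * ∑ j, ‖b j‖) =
      32 * ((d : ℝ) + 1) ^ 2 * α₀' * (M₂ * ∑ j, ‖b j‖) := by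
    rw [abs_of_nonneg (inv_nonneg.2 (sq_nonneg _))]
    calc (etaS i ^ 2)⁻¹ * (32 * ((d : ℝ) + 1) ^ 2 * α₀' * (((((ℓ + 1) ^ i.k : ℕ) : ℝ)) ^ 2)⁻¹) * (M₂ * ∑ j, ‖b j‖)
        = ((etaS i ^ 2)⁻¹ * (((((ℓ + 1) ^ i.k : ℕ) : ℝ)) ^ 2)⁻¹) * (32 * ((d : ℝ) + 1) ^ 2 * α₀') * (M₂ * ∑ j, ‖b j‖) := by ring
      _ = _ := by rw [inv_etaS_sq_mul i, one_mul]
  have e0 : ((((etaS i ^ 2)⁻¹) • (deltaPrimeAY i (parKnitY i) U - deltaPrimeAY i (parSymY i) U).restrictScalars ℝ :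
      Module.End ℝ (SiteY i → Matrix (Fin N) (Fin N) ℂ))) =
      -(((etaS i ^ 2)⁻¹) • (deltaPrimeAY i (parSymY i) U - deltaPrimeAY i (parKnitY i) U).restrictScalars ℝ) := by
    refine LinearMap.ext fun Φ => ?_
    simp only [LinearMap.smul_apply, LinearMap.neg_apply, LinearMap.restrictScalars_apply, LinearMap.sub_apply, ← smul_neg, neg_sub]
  rw [e0, conj_neg]
  exact hasMajorant_neg (g := toB6 (geo9K i) Rr Hp) _ (hasMajorant_mono (g := toB6 (geo9K i) Rr Hp) _ h fun a a' => le_of_eq (by rw [habs]))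

end Algebra

/-! ## §2  The two-space entries: LEFT at the knit letter (file 10 per direction + r06's dictionary), RIGHT at the letter of record -/

section Entries

/-- ★★ **THE TWO-SPACE LEFT ENTRY AT THE KNIT LETTER**: `conĵ(D_U)∘conj b(η²G′(U; parKnitY)) ≺ A₁(1 + c₁·θc₁(1 − θc₁)⁻¹)·ℓ(a)·e^{−(1−α)δ₀d(a,a′)}`, `θ =
32(d+1)²α₀′·M₂Σ‖b_j‖·A`, from the `parSymY` data `conj b(η²G′_S) ≺ Aℓ²e^{−δ₀d}` and the `d + 1` directional LEFT products `conj b(∂_{U,μ})·conj b(η²G′_S) ≺ A₁ℓe^{−δ₀d}`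
(file 10 per direction, then the directions summed into r06's `conĵ(gradLin)`). [cite: Balaban1985BackgroundPropagators, (3.42) p.397, (3.3) p.391, (3.90) p.409; Balaban1984PropagatorsII, (2.51)–(2.52) p.232, Lemma 2.1 p.234; Balaban1985Averaging, (52) p.27] -/
theorem hasMajorantHom_leftEntry_parKnitY [Nonempty (Fin N)] (hG : G ≤ B7Prop2Explicit.unitaryUnits (Matrix (Fin N) (Fin N) ℂ))
    (hGa : AvgClosed (d + 1) (ℓ + 1) G) {U : CfgY (Matrix (Fin N) (Fin N) ℂ) i} (hU : ∀ μ x, U μ x ∈ G)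
    {α₀' : ℝ} (hα : 0 < α₀') (hα3 : C0 (d + 1) * α₀' ≤ 1 / 3) (hα2 : 2 * α₀' ≤ c2' (d + 1) (ℓ + 1))
    (h52 : pdev (liftCfg U) < α₀' * ((((ℓ + 1 : ℕ) : ℝ) ^ i.k)⁻¹) ^ 2) (hcf : i.cf = (((ℓ + 1 : ℕ) : ℝ)) ^ i.k)
    {M₂ : ℝ} (hM₂ : 0 ≤ M₂) (hrepr : ∀ (v : Matrix (Fin N) (Fin N) ℂ) (j : ι), |b.repr v j| ≤ M₂ * ‖v‖)
    (d' : ℕ) {δ₀ α A A₁ : ℝ} (hA : 0 ≤ A) (hA₁ : 0 ≤ A₁) (hαδ : 0 ≤ (1 - α) * δ₀) (hαδ' : 0 ≤ α * δ₀)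
    (htri : Triangle254 (toB6 (geo9K i) Rr Hp)) (hrefl : ∀ y : (geo9K i).Site, (geo9K i).dist y y = 0)
    (h261 : Ineq261 d' (toB6 (geo9K i) Rr Hp) δ₀ α) (h263 : Ineq263 d' (toB6 (geo9K i) Rr Hp) δ₀ α)
    {θ : ℝ} (hθ : θ = 32 * ((d : ℝ) + 1) ^ 2 * α₀' * (M₂ * ∑ j, ‖b j‖) * A) (hsmall : θ * B6.c1 d' δ₀ α < 1) (c : ℂ)
    (hGs : HasMajorant (g := toB6 (geo9K i) Rr Hp) (fun p : SiteY i × ι => ιB (blkOf i.D.toDomains p.1))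
      (conj b ((etaS i ^ 2) • (GpY i (parSymY i) U).restrictScalars ℝ))
      (fun a a' => A * (geo9K i).len a ^ 2 * Real.exp (-(δ₀ * (geo9K i).dist a a'))))
    (hDl : ∀ μ : Fin (d + 1), HasMajorant (g := toB6 (geo9K i) Rr Hp) (fun p : SiteY i × ι => ιB (blkOf i.D.toDomains p.1))
      (conj b (diffLetter (shiftY i) (UboxY i U) c (Sum.inl μ)) * conj b ((etaS i ^ 2) • (GpY i (parSymY i) U).restrictScalars ℝ))
      (fun a a' => A₁ * (geo9K i).len a * Real.exp (-(δ₀ * (geo9K i).dist a a')))) :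
    HasMajorantHom (g := toB6 (geo9K i) Rr Hp) (fun p : SiteY i × ι => ιB (blkOf i.D.toDomains p.1))
      (fun q : (Fin (d + 1) × SiteY i) × ι => ιB (blkOf i.D.toDomains q.1.2))
      (conjHom b (gradLin (shiftY i) c (UboxY i U)) ∘ₗ conj b ((etaS i ^ 2) • (GpY i (parKnitY i) U).restrictScalars ℝ))
      (fun a a' => A₁ * (1 + B6.c1 d' δ₀ α * (θ * B6.c1 d' δ₀ α * (1 - θ * B6.c1 d' δ₀ α)⁻¹)) * (geo9K i).len a
        * Real.exp (-((1 - α) * δ₀ * (geo9K i).dist a a'))) := by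
  have hdnn : ∀ y y' : (geo9K i).Site, 0 ≤ (geo9K i).dist y y' := geo9K_dist_nonneg i
  have hK : ∀ μ : Fin (d + 1), HasMajorant (g := toB6 (geo9K i) Rr Hp) (fun p : SiteY i × ι => ιB (blkOf i.D.toDomains p.1))
      (conj b (diffLetter (shiftY i) (UboxY i U) c (Sum.inl μ)) * conj b ((etaS i ^ 2) • (GpY i (parKnitY i) U).restrictScalars ℝ))
      (fun a a' => A₁ * (1 + B6.c1 d' δ₀ α * (θ * B6.c1 d' δ₀ α * (1 - θ * B6.c1 d' δ₀ α)⁻¹)) * (geo9K i).len a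
        * Real.exp (-((1 - α) * δ₀ * (geo9K i).dist a a'))) := fun μ =>
    hasMajorant_left_conj_GpY_parKnitY_of_parSymY_len i b ιB hG hGa hU hα hα3 hα2 h52 hcf hM₂ hrepr d' (W := fun a => (geo9K i).len a)
      hA hA₁ (fun a => (geo9K_len_pos i a).le) hαδ hαδ' htri hrefl hdnn h261 h263 hθ hsmall _ hGs (hDl μ)
  exact hasMajorantHom_gradLin (g := geo9K i) (R := Rr) (H := Hp) b (shiftY i) (UboxY i U) (fun z => ιB (blkOf i.D.toDomains z)) c hK

omit [DecidableEq ι] [DecidableEq (geo9K i).Site] in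
/-- ★★ **THE TWO-SPACE RIGHT ENTRY AT THE LETTER OF RECORD**: `conj b(η²G′(U; parSymY))∘conĵ(D*_U) ≺ (d+1)A₂·ℓ(a)·e^{−δ₀d}` from the `d + 1` directional RIGHT
products `conj b(η²G′_S)·conj b(∂*_{U,ν}) ≺ A₂ℓe^{−δ₀d}` (r06's `hasMajorantHom_divLin`). [cite: Balaban1985BackgroundPropagators, (3.42) p.397, (3.8) p.392; Balaban1984PropagatorsII, (2.51)–(2.52) p.232] -/
theorem hasMajorantHom_rightEntry_parSymY (U : CfgY (Matrix (Fin N) (Fin N) ℂ) i) {δ₀ A₂ : ℝ} (c : ℂ)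
    (hDr : ∀ ν : Fin (d + 1), HasMajorant (g := toB6 (geo9K i) Rr Hp) (fun p : SiteY i × ι => ιB (blkOf i.D.toDomains p.1))
      (conj b ((etaS i ^ 2) • (GpY i (parSymY i) U).restrictScalars ℝ) * conj b (diffLetter (shiftY i) (UboxY i U) c (Sum.inr ν)))
      (fun a a' => A₂ * (geo9K i).len a * Real.exp (-(δ₀ * (geo9K i).dist a a')))) :
    HasMajorantHom (g := toB6 (geo9K i) Rr Hp) (fun q : (Fin (d + 1) × SiteY i) × ι => ιB (blkOf i.D.toDomains q.1.2))
      (fun p : SiteY i × ι => ιB (blkOf i.D.toDomains p.1))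
      (conj b ((etaS i ^ 2) • (GpY i (parSymY i) U).restrictScalars ℝ) ∘ₗ conjHom b (divLin (shiftY i) c (UboxY i U)))
      (fun a a' => ((d : ℝ) + 1) * A₂ * (geo9K i).len a * Real.exp (-(δ₀ * (geo9K i).dist a a'))) := by
  have h := hasMajorantHom_divLin (g := geo9K i) (R := Rr) (H := Hp) b (shiftY i) (UboxY i U) (fun z => ιB (blkOf i.D.toDomains z)) c hDr
  refine hasMajorantHom_mono (g := toB6 (geo9K i) Rr Hp) _ _ h fun a a' => le_of_eq ?_
  rw [Fintype.card_fin]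
  push_cast
  ring

end Entries

/-! ## §3  ★★★ The differences of the entries between the two letters (FILE 2a's `leftDiff` ∕ `rightDiff`) -/

section Differences

/-- ★★★ **THE DIFFERENCE OF THE TWO-SPACE LEFT ENTRIES**: `conĵ(D_U)∘conj b(η²G′_S) − conĵ(D_U)∘conj b(η²G′_K) ≺ (B_X·θ_E·A·Λ·c₁(d_b,δ_b,β_b))·ℓ(a)·e^{−ρd(a,a′)}`
with `B_X = A₁(1 + c₁θc₁(1−θc₁)⁻¹)` (§2), `θ_E = 32(d+1)²α₀′·M₂Σ‖b_j‖` (§1), for any `ρ ≥ 0`, base rate `δ_b ≥ 0` and fractions `α_b, β_b ≥ 0` with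
`ρ + (α_b + β_b)δ_b ≤ (1−α)δ₀`, the transfer of `ℓ²` at `(δ_b, α_b, Λ)` and (2.61) at `(δ_b, β_b)` — FILE 2a's `hasMajorantHom_leftDiff` on `X₁ − X₂ = X₂∘E∘G_S`.
[cite: Balaban1985BackgroundPropagators, (3.42) p.397, (3.90) p.409, (3.106) p.414; Balaban1984PropagatorsII, (2.50)–(2.52) p.232, Lemma 2.1 (2.60)–(2.61) p.234; Balaban1985Averaging, (52) p.27] -/
theorem hasMajorantHom_leftEntry_sym_sub_knit [Nonempty (Fin N)] (hG : G ≤ B7Prop2Explicit.unitaryUnits (Matrix (Fin N) (Fin N) ℂ))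
    (hGa : AvgClosed (d + 1) (ℓ + 1) G) {U : CfgY (Matrix (Fin N) (Fin N) ℂ) i} (hU : ∀ μ x, U μ x ∈ G)
    {α₀' : ℝ} (hα : 0 < α₀') (hα3 : C0 (d + 1) * α₀' ≤ 1 / 3) (hα2 : 2 * α₀' ≤ c2' (d + 1) (ℓ + 1))
    (h52 : pdev (liftCfg U) < α₀' * ((((ℓ + 1 : ℕ) : ℝ) ^ i.k)⁻¹) ^ 2) (hcf : i.cf = (((ℓ + 1 : ℕ) : ℝ)) ^ i.k)
    {M₂ : ℝ} (hM₂ : 0 ≤ M₂) (hrepr : ∀ (v : Matrix (Fin N) (Fin N) ℂ) (j : ι), |b.repr v j| ≤ M₂ * ‖v‖)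
    (d' : ℕ) {δ₀ α A A₁ : ℝ} (hA : 0 ≤ A) (hA₁ : 0 ≤ A₁) (hαδ : 0 ≤ (1 - α) * δ₀) (hαδ' : 0 ≤ α * δ₀)
    (htri : Triangle254 (toB6 (geo9K i) Rr Hp)) (hrefl : ∀ y : (geo9K i).Site, (geo9K i).dist y y = 0)
    (h261 : Ineq261 d' (toB6 (geo9K i) Rr Hp) δ₀ α) (h263 : Ineq263 d' (toB6 (geo9K i) Rr Hp) δ₀ α)
    {θ : ℝ} (hθ : θ = 32 * ((d : ℝ) + 1) ^ 2 * α₀' * (M₂ * ∑ j, ‖b j‖) * A) (hsmall : θ * B6.c1 d' δ₀ α < 1) (c : ℂ)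
    (hGs : HasMajorant (g := toB6 (geo9K i) Rr Hp) (fun p : SiteY i × ι => ιB (blkOf i.D.toDomains p.1))
      (conj b ((etaS i ^ 2) • (GpY i (parSymY i) U).restrictScalars ℝ))
      (fun a a' => A * (geo9K i).len a ^ 2 * Real.exp (-(δ₀ * (geo9K i).dist a a'))))
    (hDl : ∀ μ : Fin (d + 1), HasMajorant (g := toB6 (geo9K i) Rr Hp) (fun p : SiteY i × ι => ιB (blkOf i.D.toDomains p.1))
      (conj b (diffLetter (shiftY i) (UboxY i U) c (Sum.inl μ)) * conj b ((etaS i ^ 2) • (GpY i (parSymY i) U).restrictScalars ℝ))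
      (fun a a' => A₁ * (geo9K i).len a * Real.exp (-(δ₀ * (geo9K i).dist a a'))))
    -- the difference's Lemma 2.1
    (db : ℕ) {δb αb βb ρ Λ : ℝ} (hΛ : 0 ≤ Λ) (hρ : 0 ≤ ρ) (hαb : 0 ≤ αb) (hβb : 0 ≤ βb) (hδb : 0 ≤ δb) (hr : ρ + (αb + βb) * δb ≤ (1 - α) * δ₀)
    (h261b : Ineq261 db (toB6 (geo9K i) Rr Hp) δb βb) (hT2 : ScaleTransfer (geo9K i) δb αb Λ (fun a => (geo9K i).len a ^ 2)) :
    HasMajorantHom (g := toB6 (geo9K i) Rr Hp) (fun p : SiteY i × ι => ιB (blkOf i.D.toDomains p.1))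
      (fun q : (Fin (d + 1) × SiteY i) × ι => ιB (blkOf i.D.toDomains q.1.2))
      (conjHom b (gradLin (shiftY i) c (UboxY i U)) ∘ₗ conj b ((etaS i ^ 2) • (GpY i (parSymY i) U).restrictScalars ℝ) -
        conjHom b (gradLin (shiftY i) c (UboxY i U)) ∘ₗ conj b ((etaS i ^ 2) • (GpY i (parKnitY i) U).restrictScalars ℝ))
      (fun a a' => (A₁ * (1 + B6.c1 d' δ₀ α * (θ * B6.c1 d' δ₀ α * (1 - θ * B6.c1 d' δ₀ α)⁻¹)) * (32 * ((d : ℝ) + 1) ^ 2 * α₀' * (M₂ * ∑ j, ‖b j‖))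
          * A * Λ * B6.c1 db δb βb) * (geo9K i).len a * Real.exp (-(ρ * (geo9K i).dist a a'))) := by
  have hpar : ∀ z w : SiteY i, parKnitY i U z w ∈ G := fun z w => parKnitY_mem_of_pdev i hGa hU hα hα3 hα2 h52 z w
  have hη : etaS i ≠ 0 := (B9Ineq349SiteComposite.etaS_pos i).ne'
  have hdnn : ∀ y y' : (geo9K i).Site, 0 ≤ (geo9K i).dist y y' := geo9K_dist_nonneg i
  have hc0 : 0 ≤ B6.c1 d' δ₀ α := c1_nonneg d' δ₀ α
  have hθ0 : 0 ≤ θ := by rw [hθ]; exact mul_nonneg (mul_nonneg (by positivity) (mul_nonneg hM₂ (Finset.sum_nonneg fun j _ => norm_nonneg _))) hA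
  have hinv : 0 ≤ (1 - θ * B6.c1 d' δ₀ α)⁻¹ := inv_nonneg.2 (by linarith)
  have hBX : 0 ≤ A₁ * (1 + B6.c1 d' δ₀ α * (θ * B6.c1 d' δ₀ α * (1 - θ * B6.c1 d' δ₀ α)⁻¹)) :=
    mul_nonneg hA₁ (add_nonneg zero_le_one (mul_nonneg hc0 (mul_nonneg (mul_nonneg hθ0 hc0) hinv)))
  have hθE : 0 ≤ 32 * ((d : ℝ) + 1) ^ 2 * α₀' * (M₂ * ∑ j, ‖b j‖) :=
    mul_nonneg (by positivity) (mul_nonneg hM₂ (Finset.sum_nonneg fun j _ => norm_nonneg _))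
  -- X₂ (§2), E (§1), G₁ = the `parSymY` letter weakened to the rate `(1−α)δ₀`
  have hX₂ := hasMajorantHom_leftEntry_parKnitY i b ιB (Rr := Rr) (Hp := Hp) hG hGa hU hα hα3 hα2 h52 hcf hM₂ hrepr d' hA hA₁ hαδ hαδ' htri hrefl
    h261 h263 hθ hsmall c hGs hDl
  have hE := hasMajorant_conj_E i b ιB (Rr := Rr) (Hp := Hp) hG hGa hU hα hα3 hα2 h52 hM₂ hrepr
  have hG₁ : HasMajorant (g := toB6 (geo9K i) Rr Hp) (fun p : SiteY i × ι => ιB (blkOf i.D.toDomains p.1))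
      (conj b ((etaS i ^ 2) • (GpY i (parSymY i) U).restrictScalars ℝ))
      (fun a a' => A * (geo9K i).len a ^ 2 * Real.exp (-((1 - α) * δ₀ * (geo9K i).dist a a'))) := by
    refine hasMajorant_mono (g := toB6 (geo9K i) Rr Hp) _ hGs fun a a' => ?_
    exact mul_le_mul_of_nonneg_left (Real.exp_le_exp.2 (by nlinarith [hdnn a a', hαδ'])) (mul_nonneg hA (sq_nonneg _))
  rw [leftEntry_sub_eq i b hG hU hpar hη]
  exact hasMajorantHom_leftDiff (R := Rr) (H := Hp) (fun p : SiteY i × ι => ιB (blkOf i.D.toDomains p.1))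
    (fun q : (Fin (d + 1) × SiteY i) × ι => ιB (blkOf i.D.toDomains q.1.2)) db δb ((1 - α) * δ₀) αb βb ρ Λ _ _ A hBX hθE hA hΛ hρ hαb hβb hδb hr
    hdnn htri (geo9K_len_pos i) (fun a => by nlinarith [geo9K_len_sq_le_one i hcf a, geo9K_len_pos i a]) h261b hT2 hX₂ hE hG₁

/-- ★★★ **THE DIFFERENCE OF THE TWO-SPACE RIGHT ENTRIES**: `conj b(η²G′_S)∘conĵ(D*_U) − conj b(η²G′_K)∘conĵ(D*_U) ≺ (A_K·θ_E·(d+1)A₂·Λ·c₁(d_b,δ_b,β_b))·ℓ(a)·e^{−ρd}`,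
`A_K = Ac₁(1 − θc₁)⁻¹` (file 9's knit letter), from the `parSymY` data, the `d + 1` directional RIGHT products at `parSymY` (`hDr`, constant `A₂`), the
transfer of `ℓ` at `(δ_b, α_b, Λ)` and (2.61) at `(δ_b, β_b)`, `ρ + (α_b+β_b)δ_b ≤ (1−α)δ₀` — FILE 2a's `hasMajorantHom_rightDiff` on `Y₁ − Y₂ = G_K∘E∘Y₁`.
[cite: Balaban1985BackgroundPropagators, (3.42) p.397, (3.90) p.409, (3.106) p.414; Balaban1984PropagatorsII, (2.50)–(2.52) p.232, Lemma 2.1 (2.60)–(2.61) p.234; Balaban1985Averaging, (52) p.27] -/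
theorem hasMajorantHom_rightEntry_sym_sub_knit [Nonempty (Fin N)] (hG : G ≤ B7Prop2Explicit.unitaryUnits (Matrix (Fin N) (Fin N) ℂ))
    (hGa : AvgClosed (d + 1) (ℓ + 1) G) {U : CfgY (Matrix (Fin N) (Fin N) ℂ) i} (hU : ∀ μ x, U μ x ∈ G)
    {α₀' : ℝ} (hα : 0 < α₀') (hα3 : C0 (d + 1) * α₀' ≤ 1 / 3) (hα2 : 2 * α₀' ≤ c2' (d + 1) (ℓ + 1))
    (h52 : pdev (liftCfg U) < α₀' * ((((ℓ + 1 : ℕ) : ℝ) ^ i.k)⁻¹) ^ 2) (hcf : i.cf = (((ℓ + 1 : ℕ) : ℝ)) ^ i.k)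
    {M₂ : ℝ} (hM₂ : 0 ≤ M₂) (hrepr : ∀ (v : Matrix (Fin N) (Fin N) ℂ) (j : ι), |b.repr v j| ≤ M₂ * ‖v‖)
    (d' : ℕ) {δ₀ α A A₂ : ℝ} (hA : 0 ≤ A) (hA₂ : 0 ≤ A₂) (hαδ : 0 ≤ (1 - α) * δ₀) (hαδ' : 0 ≤ α * δ₀)
    (htri : Triangle254 (toB6 (geo9K i) Rr Hp)) (hrefl : ∀ y : (geo9K i).Site, (geo9K i).dist y y = 0)
    (h261 : Ineq261 d' (toB6 (geo9K i) Rr Hp) δ₀ α) (h263 : Ineq263 d' (toB6 (geo9K i) Rr Hp) δ₀ α)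
    (hsmall : (32 * ((d : ℝ) + 1) ^ 2 * α₀' * (M₂ * ∑ j, ‖b j‖) * A) * B6.c1 d' δ₀ α < 1) (c : ℂ)
    (hGs : HasMajorant (g := toB6 (geo9K i) Rr Hp) (fun p : SiteY i × ι => ιB (blkOf i.D.toDomains p.1))
      (conj b ((etaS i ^ 2) • (GpY i (parSymY i) U).restrictScalars ℝ))
      (fun a a' => A * (geo9K i).len a ^ 2 * Real.exp (-(δ₀ * (geo9K i).dist a a'))))
    (hDr : ∀ ν : Fin (d + 1), HasMajorant (g := toB6 (geo9K i) Rr Hp) (fun p : SiteY i × ι => ιB (blkOf i.D.toDomains p.1))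
      (conj b ((etaS i ^ 2) • (GpY i (parSymY i) U).restrictScalars ℝ) * conj b (diffLetter (shiftY i) (UboxY i U) c (Sum.inr ν)))
      (fun a a' => A₂ * (geo9K i).len a * Real.exp (-(δ₀ * (geo9K i).dist a a'))))
    (db : ℕ) {δb αb βb ρ Λ : ℝ} (hΛ : 0 ≤ Λ) (hρ : 0 ≤ ρ) (hαb : 0 ≤ αb) (hβb : 0 ≤ βb) (hδb : 0 ≤ δb) (hr : ρ + (αb + βb) * δb ≤ (1 - α) * δ₀)
    (h261b : Ineq261 db (toB6 (geo9K i) Rr Hp) δb βb) (hT1 : ScaleTransfer (geo9K i) δb αb Λ (fun a => (geo9K i).len a)) :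
    HasMajorantHom (g := toB6 (geo9K i) Rr Hp) (fun q : (Fin (d + 1) × SiteY i) × ι => ιB (blkOf i.D.toDomains q.1.2))
      (fun p : SiteY i × ι => ιB (blkOf i.D.toDomains p.1))
      (conj b ((etaS i ^ 2) • (GpY i (parSymY i) U).restrictScalars ℝ) ∘ₗ conjHom b (divLin (shiftY i) c (UboxY i U)) -
        conj b ((etaS i ^ 2) • (GpY i (parKnitY i) U).restrictScalars ℝ) ∘ₗ conjHom b (divLin (shiftY i) c (UboxY i U)))
      (fun a a' => (A * B6.c1 d' δ₀ α * (1 - (32 * ((d : ℝ) + 1) ^ 2 * α₀' * (M₂ * ∑ j, ‖b j‖) * A) * B6.c1 d' δ₀ α)⁻¹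
          * (32 * ((d : ℝ) + 1) ^ 2 * α₀' * (M₂ * ∑ j, ‖b j‖)) * (((d : ℝ) + 1) * A₂) * Λ * B6.c1 db δb βb)
        * (geo9K i).len a * Real.exp (-(ρ * (geo9K i).dist a a'))) := by
  have hpar : ∀ z w : SiteY i, parKnitY i U z w ∈ G := fun z w => parKnitY_mem_of_pdev i hGa hU hα hα3 hα2 h52 z w
  have hη : etaS i ≠ 0 := (B9Ineq349SiteComposite.etaS_pos i).ne'
  have hdnn : ∀ y y' : (geo9K i).Site, 0 ≤ (geo9K i).dist y y' := geo9K_dist_nonneg i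
  have hc0 : 0 ≤ B6.c1 d' δ₀ α := c1_nonneg d' δ₀ α
  have hθE : 0 ≤ 32 * ((d : ℝ) + 1) ^ 2 * α₀' * (M₂ * ∑ j, ‖b j‖) :=
    mul_nonneg (by positivity) (mul_nonneg hM₂ (Finset.sum_nonneg fun j _ => norm_nonneg _))
  have hinv : 0 ≤ (1 - (32 * ((d : ℝ) + 1) ^ 2 * α₀' * (M₂ * ∑ j, ‖b j‖) * A) * B6.c1 d' δ₀ α)⁻¹ := inv_nonneg.2 (by linarith)
  have hAK : 0 ≤ A * B6.c1 d' δ₀ α * (1 - (32 * ((d : ℝ) + 1) ^ 2 * α₀' * (M₂ * ∑ j, ‖b j‖) * A) * B6.c1 d' δ₀ α)⁻¹ :=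
    mul_nonneg (mul_nonneg hA hc0) hinv
  have hBY : 0 ≤ ((d : ℝ) + 1) * A₂ := mul_nonneg (by positivity) hA₂
  -- G₂ = the knit letter (file 9), E (§1), Y₁ (§2) weakened to the rate `(1−α)δ₀`
  have hG₂ := hasMajorant_conj_GpY_parKnitY_of_parSymY_len i b ιB (Rr := Rr) (Hp := Hp) hG hGa hU hα hα3 hα2 h52 hcf hM₂ hrepr d' hA hαδ htri hrefl hdnn
    h261 h263 hsmall hGs
  have hE := hasMajorant_conj_E i b ιB (Rr := Rr) (Hp := Hp) hG hGa hU hα hα3 hα2 h52 hM₂ hrepr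
  have hY₁ : HasMajorantHom (g := toB6 (geo9K i) Rr Hp) (fun q : (Fin (d + 1) × SiteY i) × ι => ιB (blkOf i.D.toDomains q.1.2))
      (fun p : SiteY i × ι => ιB (blkOf i.D.toDomains p.1))
      (conj b ((etaS i ^ 2) • (GpY i (parSymY i) U).restrictScalars ℝ) ∘ₗ conjHom b (divLin (shiftY i) c (UboxY i U)))
      (fun a a' => ((d : ℝ) + 1) * A₂ * (geo9K i).len a * Real.exp (-((1 - α) * δ₀ * (geo9K i).dist a a'))) := by
    refine hasMajorantHom_mono (g := toB6 (geo9K i) Rr Hp) _ _ (hasMajorantHom_rightEntry_parSymY i b ιB (Rr := Rr) (Hp := Hp) U c hDr) fun a a' => ?_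
    exact mul_le_mul_of_nonneg_left (Real.exp_le_exp.2 (by nlinarith [hdnn a a', hαδ'])) (mul_nonneg hBY (geo9K_len_pos i a).le)
  rw [rightEntry_sub_eq i b hG hU hpar hη]
  exact hasMajorantHom_rightDiff (R := Rr) (H := Hp) (fun q : (Fin (d + 1) × SiteY i) × ι => ιB (blkOf i.D.toDomains q.1.2))
    (fun p : SiteY i × ι => ιB (blkOf i.D.toDomains p.1)) db δb ((1 - α) * δ₀) αb βb ρ Λ _ _ _ hAK hθE hBY hΛ hρ hαb hβb hδb hr
    hdnn htri (geo9K_len_pos i) (fun a => by nlinarith [geo9K_len_sq_le_one i hcf a, geo9K_len_pos i a]) h261b hT1 hG₂ hE hY₁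

end Differences

end Literature.MathematicalPhysics.QuantumFieldTheory.Balaban1983to89.B9B8KnitBondGpLettersAtPars

end
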